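import Summits.AtomisticToContinuum.FouriersLaw.Theorems.BondHeatUncertaintySubdiffusiveBondHeatEscapeGrading
import Summits.AtomisticToContinuum.FouriersLaw.Theorems.BondHeatUncertaintySubdiffusiveBondHeatJunctionKernel

/-!
# `JunctionDefectGrading` — the junction-defect exponent `θ` of the escape-resistance series law, graded
# (cell `decomp-a2c`, lens-1 «grading / quantitative ladder», gen 56; ON PATH to the blocker 11071; file 2 of 2, imports the kernel file 1)

Branch of record `N_F = FouriersLaw`; blocker stmt-AtomisticToContinuum-11071 `BondHeatUncertainty.BoundedResponse`
(⟺ the Ohmic floor at the contact `E_N(T) ≤ C₁(T)/N` eventually, tree theorem `boundedResponse_iff_ohmicFloor`).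
Dictionary (ONE scalar, E-frame): `E_N(T)` = the boundary escape deficit (`escapeDeficit`, VERBATIM the tree expression);
`r_N := 1/E_N = γ·R_N`, `R_N = (N−1)/D_N` the end-to-end resistance, by the PROVED response identity `D_N = (N−1)γE_N`
(`boundaryEscapeDeficit_responseIdentity_holds`) along any steady-state family (weak-NESS uniqueness is a tree theorem).

## The axis graded: the defect exponent of the series law
`JunctionLaw θ`:  `1/E_N + 1/E_M − C·(N+M)^θ ≤ 1/E_{N+M}`  (`N, M ≥ 2`, `C = C(T) ≥ 0`).  The tree books ONLY the endpoint `θ = 0` (uniform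
junction defect): `JunctionLocality.SuperadditiveResistance` 11748 (open, XL), its Fekete glue 11751 (proved), the twins `FeketeSeriesLaw` 14041,
`MatthiessenIncrements`, `CageBudgetFekete`; and, for the CONVERGENCE half of Fourier (RLE 24580 / 9141) only, the de Bruijn–Erdős weakening with
SUMMABLE dyadic defect (`EscapeDeficitDichotomy.…summableDefect…`).  Nobody books the BOUNDEDNESS half (11071) under a GROWING defect `C·(N+M)^θ`.
That is this node: a two-exponent split of 11071 with a PROVED kernel and a PROVED sharp threshold.

## Pieces (each a `Prop` over tree vocabulary; the scalar and both floor pieces are the TREE decls of `EscapeGrading`, p841511 — reused, not restated)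
* `EscapeGrading.OhmicFloor` — EQUIV · COSTUME of 11071 (the single admissible EQUIV layer; tree `ohmicFloor_iff_boundedResponse`).
* `EscapeGrading.ExponentFloor s` (`E_N ≤ C/N^s` eventually) = the floor piece `F(s)` — `s = 1`: COSTUME of 11071 (tree
  `exponentFloor_one_iff_boundedResponse`); `s < 1`: WEAKER (tree `exponentFloor_of_boundedResponse`) · UNDECIDED · IDEA-NEEDED · INSTRUMENTABLE
  (census T6 apparent exponents); `s ≤ 0` PROVED (tree `exponentFloor_zero_of_le_one`).  NEW: gen-55's planless bootstrap half
  `ExponentBootstrap s` gets an OWNER here — `exponentBootstrap_of_junctionLaw : J(θ) → B(s)` for every `θ < s`.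
* `JunctionLaw θ` — `θ = 0`: COSTUME of 11748 in the E-frame (`junctionLaw_zero_iff_superadditiveResistance`, proved both ways via the
  response identity and `PositiveConductance`, a tree theorem); `0 < θ < 1`: STRICTLY WEAKER than 11748 (`junctionLaw_mono`) · UNDECIDED ·
  IDEA-NEEDED · INSTRUMENTABLE (census T11/T11c measure exactly the defect `C₀(N,M) = R_N + R_M − R_{N+M}`); carries NO Fourier content on
  its own (`junction_of_bounded`: every bounded nonnegative sequence obeys every `J(θ)` — the harmonic / Rieder–Lebowitz–Lieb calibration,
  where `E_N → E_∞ > 0`); `θ ≥ 1`: implied by a linear conductance floor (`junctionLaw_of_conductanceFloor`, REP-side, 11749-type) and inert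
  (it would need a floor exponent `s > 1`, which is stronger than 11071 and false in evidence).
* `DoublingLaw θ` — the NEAR-DIAGONAL part of `J(θ)` (pairs `M = N`, `M = N + 1` only): `2/E_N − C·(2N)^θ ≤ 1/E_{2N}` and
  `1/E_N + 1/E_{N+1} − C·(2N+1)^θ ≤ 1/E_{2N+1}`.  It is ALL the kernel consumes.  WEAKER than `J(θ)` (`doublingLaw_of_junctionLaw`; shape-strictly:
  tree witness `SuperadditiveResistance.Negative.twoSidedDoubling_not_sufficient`); `θ = 0` = the E-frame shape of the 11748 line's STUCK stub
  `stub_evenDoubling` (`2R_N − C₁ ≤ R_{2N}`, line `diagonal-split-series-law`, lead seats c19–c27) plus its odd companion — so any even/odd doubling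
  bound the 11748 programme extracts, even with a constant growing like `N^θ`, `θ < s_obs`, lands 11071 through this node; `0 < θ < 1`: UNDECIDED ·
  IDEA-NEEDED · INSTRUMENTABLE (the census DIAGONAL defects `C₀(N,N)`); `θ ≥ 1` inert.
* `ConductanceFloor` (`c(T) ≤ N·E_N`, `N ≥ 2`) — WEAKER than REP 24581-type statements; context for the top of the ladder only (`aside`).

## The kernel (PROVED, 0 sorry) — file 1 `…SubdiffusiveBondHeatJunctionKernel`
`linear_of_doubling_of_floor` (near-diagonal binary Fekete with gain; all-pairs corollary `linear_of_superadditive_of_floor`), sharp both ways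
(`threshold_sharp`: `s > θ` cannot be `s ≥ θ`; `evenDoubling_not_sufficient`: the odd pairs `M = N + 1` cannot be dropped), `junction_of_bounded` (independence).
Here: 11071 ⟸ D(θ) ∧ F(s) ⟸ J(θ) ∧ F(s) for every `0 ≤ θ < s ≤ 1`, every piece strictly WEAKER than its booked endpoint (11748, resp. 11071) when
`0 < θ`, `s < 1`; the residual is PRICED by two measurable exponents (below); one EQUIV layer (`OhmicFloor`).

## Instrument reading (census `COSTUME-CENSUS-v21` §T11/§T11c = jobs j338956 + T6 j337563, ω₂ = lam = β = γ = 1; QUOTED, not recomputed)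
Fekete defect `C₀(N,M) = R_N + R_M − R_{N+M}`:  T=1: (8,8) 5.020±0.024, (8,16) 4.990, (8,32) 5.063, (8,64) 5.088;  T=3: 3.965, 4.046,
4.106, (32,32) 4.19;  T=10: 3.295, 3.293, 3.309, (64,64) 3.4;  T=0.1: 7.104±0.070, 7.137, 7.138, (16,16) 7.118.  §T11c (N ≤ 1024): at T = 1
the growing forms `a + b√N` (χ²/dof 0.96) and `a + b·log N` (1.21) beat the bounded form `a − b/N` (2.66) ⇒ `θ_obs(T=1) ∈ (0, 1/2]`, the
uniform-defect endpoint `θ = 0` (11748 as typed) is NOT instrument-consistent in window (census v5 TAG UPDATE 17: "de Bruijn–Erdős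
weakening recommended"); T ≥ 3 undecidable (`θ = 0` allowed).  Floor side (T6 fits `D_N = κN/(N+ℓ)`, apparent `d log D/d log N` = 0.39 /
0.25 / 0.125 at T = 1 / 3 / 10, N ≤ 1024–2048): in-window `s_obs = 1 − (that) ≈ 0.61 / 0.75 / 0.875`.  The kernel's open region `s > θ`
CONTAINS the measured pair at every census temperature — `(θ,s)_obs ≈ (½, 0.61)` at T = 1, `(0, 0.75)`, `(0, 0.875)` — i.e. this split is
instrument-consistent exactly where the uniform-defect split `11748 ∧ (Ohmic Fekete)` is not.

## Leaves
`D(θ)` / `J(θ)`, `0 < θ < 1`: IDEA-NEEDED (candidate owner: the junction-repair step of 11748's Dirichlet–Thomson saddle — line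
`diagonal-split-series-law`, stub `stub_evenDoubling` — with a re-thermalisation cost allowed to grow like the contact depth `(2N)^θ` instead of
`O(1)`; contact cross-correlation decay) · INSTRUMENTABLE now (T11c two-parameter fit of `C₀(N,N)`, `C₀(N,N+1)`, `C₀(N,M)` vs `(N+M)^θ`).  `F(s)`, `θ < s < 1`: IDEA-NEEDED (as gen 55: no technique short of the Ohmic ones gives a
power of `N` at the contact) · INSTRUMENTABLE.  BARRIER: none of the catalogue is engaged by the kernel (real analysis); the leaves inherit
the placements of 11748 / 11071.  Presearch (EXCERPT-g56.md): tree = summable-defect CONVERGENCE Fekete only; nothing of this shape in corpus / galaxy.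
Imports: the tree module `…SubdiffusiveBondHeatEscapeGrading` (gen-55 node, p841511) and the kernel file 1; `E_N > 0` is re-derived here
(`escapeDeficit_pos`) from built imports (`…PositiveOrInfiniteLimitSplit` had no built olean at gen 56).  No `sorry`; standard axioms only.
-/

noncomputable section

open MeasureTheory Filter Topology Set
open Literature.MathematicalPhysics.KineticTheory.HeatConduction

namespace Summit.AtomisticToContinuum.FouriersLaw.Theorems.SubdiffusiveBondHeat

namespace JunctionDefectGrading

open Summit.AtomisticToContinuum.FouriersLaw.Theses.BondHeatUncertainty (BoundedResponse)
open Summit.AtomisticToContinuum.FouriersLaw.Theses.JunctionLocality (SuperadditiveResistance PositiveConductance)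
open Summit.AtomisticToContinuum.FouriersLaw.Theorems.SubdiffusiveBondHeat.EscapeGrading
  (escapeDeficit OhmicFloor ohmicFloor_iff_boundedResponse ExponentFloor ExponentBootstrap exponentFloor_anti
    exponentFloor_one_iff_ohmicFloor exponentFloor_one_iff_boundedResponse exponentFloor_of_boundedResponse)

/-! ## B. The graded scalar and the canonical response family -/

/-! The graded scalar `E_N(T)` is the TREE definition `EscapeGrading.escapeDeficit` (module `…SubdiffusiveBondHeatEscapeGrading`,
p841511; VERBATIM the inline expression of `boundedResponse_iff_ohmicFloor`), opened above — not restated. -/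

/-- **The canonical response family.**  Along the steady-state family chosen from `pinnedChain_exists_isSteadyState`, the response
limits exist and equal `D_N = (N−1)γE_N` (`N ≥ 1`; `D_0 = 0`) — the proved response identity + weak-NESS uniqueness, exactly as in
`ohmicFloor_of_boundedResponse`. [folklore] -/
theorem exists_canonical_response {ω₂ lam β γ : ℝ} (hω : 0 < ω₂) (hl : 0 < lam) (hβ : 0 < β) (hγ : 0 < γ)
    {T : ℝ} (hT : 0 < T) :
    ∃ μ : (N : ℕ) → ℝ → ℝ → Measure (PhaseSpace N),
      (∀ (N : ℕ) (T_L T_R : ℝ), 0 < T_L → 0 < T_R →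
          (pinnedChain ω₂ lam β γ).IsSteadyState N T_L T_R (μ N T_L T_R)) ∧
      ∃ D : ℕ → ℝ,
        (∀ N : ℕ, Tendsto
            (fun δ : ℝ => (pinnedChain ω₂ lam β γ).totalCurrent (μ N (T + δ / 2) (T - δ / 2)) / δ)
            (𝓝[≠] 0) (𝓝 (D N))) ∧
        ∀ N : ℕ, 0 < N → D N = ((N : ℝ) - 1) * γ * escapeDeficit ω₂ lam β γ T N := by
  classical
  have huniq := bondHeatUncertainty_nessUnique_holds ω₂ lam β γ hω hl hβ hγ
  let μ₀ : (N : ℕ) → ℝ → ℝ → Measure (PhaseSpace N) := fun N T_L T_R =>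
    if h : 0 < T_L ∧ 0 < T_R then
      Classical.choose (pinnedChain_exists_isSteadyState hω hl hβ hγ N h.1 h.2) else 0
  have hμ₀ : ∀ (N : ℕ) (T_L T_R : ℝ), 0 < T_L → 0 < T_R →
      (pinnedChain ω₂ lam β γ).IsSteadyState N T_L T_R (μ₀ N T_L T_R) := by
    intro N T_L T_R hL' hR'
    simp only [μ₀, dif_pos (And.intro hL' hR')]
    exact Classical.choose_spec (pinnedChain_exists_isSteadyState hω hl hβ hγ N hL' hR')
  have hRI := boundaryEscapeDeficit_responseIdentity_holds ω₂ lam β γ hω hl hβ hγ huniq μ₀ hμ₀ T hT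
  dsimp only at hRI
  let D : ℕ → ℝ := fun N => if N = 0 then 0 else ((N : ℝ) - 1) * γ * escapeDeficit ω₂ lam β γ T N
  have hDpos : ∀ N : ℕ, 0 < N → D N = ((N : ℝ) - 1) * γ * escapeDeficit ω₂ lam β γ T N := fun N hN => by
    simp [D, hN.ne']
  refine ⟨μ₀, hμ₀, D, fun N => ?_, hDpos⟩
  rcases Nat.eq_zero_or_pos N with rfl | hN
  · have hD0 : D 0 = 0 := by simp [D]
    rw [hD0]
    simp only [OscillatorChain.totalCurrent_zero, zero_div]
    exact tendsto_const_nhds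
  · rw [hDpos N hN]
    exact (hRI N hN).2

/-- **`0 < E_N(T)` for `N ≥ 2`** — `PositiveConductance` (tree theorem `…ThermaliseThenCutProbeInsertion.positiveConductance_proof`)
along the canonical family, divided by `(N−1)γ > 0`.  (In tree under an unbuilt module as `EscapeDeficitDichotomy.stub_escapeDeficitPos`;
re-derived here from built imports.) [folklore] -/
theorem escapeDeficit_pos {ω₂ lam β γ : ℝ} (hω : 0 < ω₂) (hl : 0 < lam) (hβ : 0 < β) (hγ : 0 < γ)
    {T : ℝ} (hT : 0 < T) {N : ℕ} (hN : 2 ≤ N) : 0 < escapeDeficit ω₂ lam β γ T N := by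
  obtain ⟨μ, hμ, D, hD, hDE⟩ := exists_canonical_response hω hl hβ hγ hT
  have huniq := bondHeatUncertainty_nessUnique_holds ω₂ lam β γ hω hl hβ hγ
  have hpc :=
    Summit.AtomisticToContinuum.FouriersLaw.Cruxes.SuperadditiveResistance.ThermaliseThenCutProbeInsertion.positiveConductance_proof
      ω₂ lam β γ hω hl hβ hγ huniq μ hμ T hT D hD N hN
  rw [hDE N (by omega)] at hpc
  have h1 : 0 < ((N : ℝ) - 1) * γ := by
    have h2 : (2 : ℝ) ≤ N := by exact_mod_cast hN
    exact mul_pos (by linarith) hγ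
  exact lt_of_mul_lt_mul_left (by rw [mul_zero]; exact hpc) h1.le

/-! ## C. The pieces -/

/-! The two floor pieces are the TREE `Prop`s `EscapeGrading.OhmicFloor` (EQUIV · COSTUME of 11071, `ohmicFloor_iff_boundedResponse`)
and `EscapeGrading.ExponentFloor s` (`E_N ≤ C/N^s` eventually; `s = 1` COSTUME of 11071 by `exponentFloor_one_iff_boundedResponse`, `s < 1`
WEAKER by `exponentFloor_of_boundedResponse`, `s ≤ 0` PROVED by `exponentFloor_zero_of_le_one`; UNDECIDED · IDEA-NEEDED · INSTRUMENTABLE for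
`0 < s < 1`: T6 in-window `s_obs ≈ 0.61 / 0.75 / 0.875` at T = 1 / 3 / 10) — opened above, not restated.  New here: -/

/-- **Junction law with defect exponent `θ`**: `1/E_N + 1/E_M − C·(N+M)^θ ≤ 1/E_{N+M}` for `N, M ≥ 2`, `C = C(T) ≥ 0` — the series law
of escape resistances at a junction up to a defect growing like the `θ`-th power of the total length.  Tags: `θ = 0` COSTUME of 11748
(`junctionLaw_zero_iff_superadditiveResistance`); `0 < θ < 1` STRICTLY WEAKER than 11748 (`junctionLaw_mono`) · UNDECIDED · IDEA-NEEDED ·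
INSTRUMENTABLE (T11c: `θ_obs(T=1) ∈ (0, 1/2]`, `θ_obs = 0` allowed at T ≥ 3); `θ ≥ 1` REP-grade (`junctionLaw_of_conductanceFloor`) and inert;
no Fourier content alone (`junction_of_bounded`). [piece · rung] -/
def JunctionLaw (θ : ℝ) : Prop :=
  ∀ ω₂ lam β γ : ℝ, 0 < ω₂ → 0 < lam → 0 < β → 0 < γ → ∀ T : ℝ, 0 < T →
    ∃ C : ℝ, 0 ≤ C ∧ ∀ N M : ℕ, 2 ≤ N → 2 ≤ M →
      1 / escapeDeficit ω₂ lam β γ T N + 1 / escapeDeficit ω₂ lam β γ T M - C * ((N : ℝ) + M) ^ θ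
        ≤ 1 / escapeDeficit ω₂ lam β γ T (N + M)

/-- **Doubling law with defect exponent `θ`** (the NEAR-DIAGONAL part of `JunctionLaw θ`: only the pairs `M = N` and `M = N + 1`):
`2/E_N − C·(2N)^θ ≤ 1/E_{2N}` and `1/E_N + 1/E_{N+1} − C·(2N+1)^θ ≤ 1/E_{2N+1}` for `N ≥ 2`.  This is ALL the kernel consumes.  Tags:
WEAKER than `JunctionLaw θ` (`doublingLaw_of_junctionLaw`; at the level of shapes STRICTLY — tree witness
`SuperadditiveResistance.Negative.twoSidedDoubling_not_sufficient`: `R_{2N} = 2R_N` exactly, odd doubling free, insertion defect `3·2^j`);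
`θ = 0`: the E-frame shape of the 11748 line's stuck stub `stub_evenDoubling` (`2R_N − C₁ ≤ R_{2N}`, line `diagonal-split-series-law`, lead seats
c19–c27) together with its odd companion — WEAKER than 11748; `0 < θ < 1`: UNDECIDED · IDEA-NEEDED · INSTRUMENTABLE (the census diagonal defects
`C₀(N,N)`: T = 1 (8,8) 5.02, T = 3 (32,32) 4.19, T = 10 (64,64) 3.4, T = 0.1 (16,16) 7.12); `θ ≥ 1` inert. [piece · rung] -/
def DoublingLaw (θ : ℝ) : Prop :=
  ∀ ω₂ lam β γ : ℝ, 0 < ω₂ → 0 < lam → 0 < β → 0 < γ → ∀ T : ℝ, 0 < T →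
    ∃ C : ℝ, 0 ≤ C ∧ ∀ N M : ℕ, 2 ≤ N → (M = N ∨ M = N + 1) →
      1 / escapeDeficit ω₂ lam β γ T N + 1 / escapeDeficit ω₂ lam β γ T M - C * ((N : ℝ) + M) ^ θ
        ≤ 1 / escapeDeficit ω₂ lam β γ T (N + M)

/-- `J(θ) ⟹ D(θ)` (restriction to the near-diagonal pairs). [folklore] -/
theorem doublingLaw_of_junctionLaw {θ : ℝ} : JunctionLaw θ → DoublingLaw θ := by
  intro hJ ω₂ lam β γ hω hl hβ hγ T hT
  obtain ⟨C, hC, h⟩ := hJ ω₂ lam β γ hω hl hβ hγ T hT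
  exact ⟨C, hC, fun N M hN hM => h N M hN (by omega)⟩

/-- **Linear conductance floor** `0 < c(T) ≤ N·E_N(T)` (`N ≥ 2`), i.e. `D_N ≥ (N−1)γc/N ≥ γc/2`: a REP-24581-type lower bound (WEAKER than
`ConductanceLowerBound` 11749 ∧ finite positive limit).  Context for the top corner of the ladder only. [piece · aside] -/
def ConductanceFloor : Prop :=
  ∀ ω₂ lam β γ : ℝ, 0 < ω₂ → 0 < lam → 0 < β → 0 < γ → ∀ T : ℝ, 0 < T →
    ∃ c : ℝ, 0 < c ∧ ∀ N : ℕ, 2 ≤ N → c ≤ (N : ℝ) * escapeDeficit ω₂ lam β γ T N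

/-! ## D. The kernel in the frame: `D(θ) ∧ F(s) ⟹ 11071` (hence `J(θ) ∧ F(s) ⟹ 11071`) for `θ < s ≤ 1` -/

/-- **`DoublingLaw θ → ExponentFloor s → OhmicFloor`** for `0 ≤ θ < s ≤ 1`: the sequence kernel applied to `r_N = 1/E_N(T)` at each
temperature (`E_N > 0` by `escapeDeficit_pos`; the floor constant is then positive and `N^s/C ≤ r_N`). [kernel · frame] -/
theorem ohmicFloor_of_doublingLaw_of_exponentFloor {θ s : ℝ} (hθ : 0 ≤ θ) (hθs : θ < s) (hs : s ≤ 1)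
    (hJ : DoublingLaw θ) (hF : ExponentFloor s) : OhmicFloor := by
  intro ω₂ lam β γ hω hl hβ hγ T hT
  obtain ⟨C, hC, hJ'⟩ := hJ ω₂ lam β γ hω hl hβ hγ T hT
  obtain ⟨c', N₁, hF'⟩ := hF ω₂ lam β γ hω hl hβ hγ T hT
  have hpos : ∀ N : ℕ, 2 ≤ N → 0 < escapeDeficit ω₂ lam β γ T N := fun N hN =>
    escapeDeficit_pos hω hl hβ hγ hT hN
  -- the floor constant is positive (evaluate at `max N₁ 2`)
  have hc' : 0 < c' := by
    have hle := hF' (max N₁ 2) (le_max_left _ _)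
    have hE := hpos (max N₁ 2) (le_max_right _ _)
    have hx : (0 : ℝ) < ((max N₁ 2 : ℕ) : ℝ) ^ s :=
      Real.rpow_pos_of_pos (by exact_mod_cast lt_of_lt_of_le (by norm_num) (le_max_right N₁ 2)) s
    have h := lt_of_lt_of_le hE hle
    by_contra hcn
    push Not at hcn
    have : c' / ((max N₁ 2 : ℕ) : ℝ) ^ s ≤ 0 := div_nonpos_iff.mpr (Or.inr ⟨hcn, hx.le⟩)
    linarith
  -- the floor for `r_N = 1/E_N`: `N^s/c' ≤ r_N` beyond `max N₁ 2`
  have hFr : ∀ N : ℕ, max N₁ 2 ≤ N → 1 / c' * (N : ℝ) ^ s ≤ 1 / escapeDeficit ω₂ lam β γ T N := by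
    intro N hN
    have hE := hpos N (le_trans (le_max_right _ _) hN)
    have hle := hF' N (le_trans (le_max_left _ _) hN)
    have hx : (0 : ℝ) < (N : ℝ) ^ s :=
      Real.rpow_pos_of_pos (by exact_mod_cast lt_of_lt_of_le (by norm_num) (le_trans (le_max_right N₁ 2) hN)) s
    have h1 : escapeDeficit ω₂ lam β γ T N * (N : ℝ) ^ s ≤ c' := (le_div_iff₀ hx).mp hle
    rw [one_div_mul_eq_div, div_le_iff₀ hc', one_div_mul_eq_div, le_div_iff₀ hE, mul_comm]
    exact h1
  obtain ⟨a, ha, N₀, hlin⟩ := linear_of_doubling_of_floor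
    (r := fun N => 1 / escapeDeficit ω₂ lam β γ T N) hθ hθs hs hC (one_div_pos.mpr hc') hJ' hFr
  refine ⟨1 / a, max N₀ 2, fun N hN => ?_⟩
  have hE := hpos N (le_trans (le_max_right _ _) hN)
  have hNpos : (0 : ℝ) < N := by
    exact_mod_cast lt_of_lt_of_le (by norm_num) (le_trans (le_max_right N₀ 2) hN)
  have h : a * (N : ℝ) ≤ 1 / escapeDeficit ω₂ lam β γ T N := hlin N (le_trans (le_max_left _ _) hN)
  have h' : a * (N : ℝ) * escapeDeficit ω₂ lam β γ T N ≤ 1 := (le_div_iff₀ hE).mp h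
  rw [div_div, le_div_iff₀ (mul_pos ha hNpos)]
  calc escapeDeficit ω₂ lam β γ T N * (a * N) = a * (N : ℝ) * escapeDeficit ω₂ lam β γ T N := by ring
    _ ≤ 1 := h'

/-- **THE NODE (near-diagonal form): `DoublingLaw θ → ExponentFloor s → BoundedResponse` (11071) for `0 ≤ θ < s ≤ 1`.** [kernel · frame] -/
theorem boundedResponse_of_doublingLaw_of_exponentFloor {θ s : ℝ} (hθ : 0 ≤ θ) (hθs : θ < s) (hs : s ≤ 1) :
    DoublingLaw θ → ExponentFloor s → BoundedResponse := fun hD hF =>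
  ohmicFloor_iff_boundedResponse.1 (ohmicFloor_of_doublingLaw_of_exponentFloor hθ hθs hs hD hF)

/-- **`JunctionLaw θ → ExponentFloor s → OhmicFloor`** for `0 ≤ θ < s ≤ 1` (through `doublingLaw_of_junctionLaw`). [kernel · frame] -/
theorem ohmicFloor_of_junctionLaw_of_exponentFloor {θ s : ℝ} (hθ : 0 ≤ θ) (hθs : θ < s) (hs : s ≤ 1)
    (hJ : JunctionLaw θ) (hF : ExponentFloor s) : OhmicFloor :=
  ohmicFloor_of_doublingLaw_of_exponentFloor hθ hθs hs (doublingLaw_of_junctionLaw hJ) hF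

/-- **THE NODE: `JunctionLaw θ → ExponentFloor s → BoundedResponse` (11071) for `0 ≤ θ < s ≤ 1`.** [kernel · frame] -/
theorem boundedResponse_of_junctionLaw_of_exponentFloor {θ s : ℝ} (hθ : 0 ≤ θ) (hθs : θ < s) (hs : s ≤ 1) :
    JunctionLaw θ → ExponentFloor s → BoundedResponse := fun hJ hF =>
  ohmicFloor_iff_boundedResponse.1 (ohmicFloor_of_junctionLaw_of_exponentFloor hθ hθs hs hJ hF)

/-- The instrument-preferred instance at `T = 1` (`θ_obs ≤ 1/2 < 0.61 ≈ s_obs`): `J(1/2) ∧ F(2/3) ⟹ 11071`. [kernel · instance] -/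
theorem boundedResponse_of_junctionLaw_half_exponentFloor_twoThirds :
    JunctionLaw (1 / 2) → ExponentFloor (2 / 3) → BoundedResponse :=
  boundedResponse_of_junctionLaw_of_exponentFloor (by norm_num) (by norm_num) (by norm_num)

/-! ## E. Corners, monotonicity, costumes -/

/-! Floor-ladder monotonicity and corners are the tree theorems `exponentFloor_anti`, `exponentFloor_one_iff_ohmicFloor`,
`exponentFloor_one_iff_boundedResponse`, `exponentFloor_of_boundedResponse` (opened above). -/

/-- **The junction law OWNS gen-55's bootstrap half.**  `ExponentBootstrap s := ExponentFloor s → ExponentFloor 1` (tree, planless at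
gen 55: "no owner short of the Ohmic techniques").  For every `θ < s` (`0 ≤ θ`, `s ≤ 1`) the junction law `J(θ)` PROVES `B(s)`:
the bootstrap from exponent `s` to exponent `1` is exactly what a series law with a smaller defect exponent delivers. [kernel · frame] -/
theorem exponentBootstrap_of_junctionLaw {θ s : ℝ} (hθ : 0 ≤ θ) (hθs : θ < s) (hs : s ≤ 1) (hJ : JunctionLaw θ) :
    ExponentBootstrap s := fun hF =>
  exponentFloor_one_iff_ohmicFloor.2 (ohmicFloor_of_junctionLaw_of_exponentFloor hθ hθs hs hJ hF)

/-- The doubling law already owns the bootstrap: `D(θ) ⟹ B(s)` for `θ < s`. [kernel · frame] -/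
theorem exponentBootstrap_of_doublingLaw {θ s : ℝ} (hθ : 0 ≤ θ) (hθs : θ < s) (hs : s ≤ 1) (hD : DoublingLaw θ) :
    ExponentBootstrap s := fun hF =>
  exponentFloor_one_iff_ohmicFloor.2 (ohmicFloor_of_doublingLaw_of_exponentFloor hθ hθs hs hD hF)

/-- **Monotonicity of the doubling ladder**: `θ ≤ θ' ⟹ D(θ) ⟹ D(θ')`. [folklore] -/
theorem doublingLaw_mono {θ θ' : ℝ} (hθθ' : θ ≤ θ') : DoublingLaw θ → DoublingLaw θ' := by
  intro hD ω₂ lam β γ hω hl hβ hγ T hT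
  obtain ⟨C, hC, h⟩ := hD ω₂ lam β γ hω hl hβ hγ T hT
  refine ⟨C, hC, fun N M hN hM => ?_⟩
  have hNM1 : (1 : ℝ) ≤ (N : ℝ) + M := by
    have : (2 : ℝ) ≤ N := by exact_mod_cast hN
    have : (2 : ℝ) ≤ M := by exact_mod_cast (show 2 ≤ M by omega)
    linarith
  have hpow : ((N : ℝ) + M) ^ θ ≤ ((N : ℝ) + M) ^ θ' := Real.rpow_le_rpow_of_exponent_le hNM1 hθθ'
  have hCpow : C * ((N : ℝ) + M) ^ θ ≤ C * ((N : ℝ) + M) ^ θ' := mul_le_mul_of_nonneg_left hpow hC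
  linarith [h N M hN hM]

/-- **Monotonicity of the junction ladder**: `θ ≤ θ' ⟹ J(θ) ⟹ J(θ')` (same constant; `(N+M)^θ ≤ (N+M)^{θ'}` as `N + M ≥ 1`).
Hence every `J(θ)`, `θ ≥ 0`, is WEAKER than 11748 (`= J(0)`). [folklore] -/
theorem junctionLaw_mono {θ θ' : ℝ} (hθθ' : θ ≤ θ') : JunctionLaw θ → JunctionLaw θ' := by
  intro hJ ω₂ lam β γ hω hl hβ hγ T hT
  obtain ⟨C, hC, h⟩ := hJ ω₂ lam β γ hω hl hβ hγ T hT
  refine ⟨C, hC, fun N M hN hM => ?_⟩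
  have hNM1 : (1 : ℝ) ≤ (N : ℝ) + M := by
    have : (2 : ℝ) ≤ N := by exact_mod_cast hN
    have : (2 : ℝ) ≤ M := by exact_mod_cast hM
    linarith
  have hpow : ((N : ℝ) + M) ^ θ ≤ ((N : ℝ) + M) ^ θ' := Real.rpow_le_rpow_of_exponent_le hNM1 hθθ'
  have hCpow : C * ((N : ℝ) + M) ^ θ ≤ C * ((N : ℝ) + M) ^ θ' := mul_le_mul_of_nonneg_left hpow hC
  linarith [h N M hN hM]

/-- **`J(0) ⟹ 11748`** (`SuperadditiveResistance`, D-frame, every steady family): along any steady family with positive response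
coefficients, `D_K = (K−1)γE_K` (response identity + uniqueness of limits), so `(K−1)/D_K = (1/γ)(1/E_K)` and the E-frame law with
constant `C` is the D-frame law with constant `C/γ`. [costume · corner] -/
theorem superadditiveResistance_of_junctionLaw_zero (hJ : JunctionLaw 0) : SuperadditiveResistance := by
  intro ω₂ lam β γ hω hl hβ hγ hU μ hμ T hT D hD hDpos
  obtain ⟨C, hC, h⟩ := hJ ω₂ lam β γ hω hl hβ hγ T hT
  have hRI := boundaryEscapeDeficit_responseIdentity_holds ω₂ lam β γ hω hl hβ hγ hU μ hμ T hT
  dsimp only at hRI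
  have hDK : ∀ K : ℕ, 0 < K → D K = ((K : ℝ) - 1) * γ * escapeDeficit ω₂ lam β γ T K := fun K hK =>
    tendsto_nhds_unique (hD K) (hRI K hK).2
  have hres : ∀ K : ℕ, 2 ≤ K → 1 / escapeDeficit ω₂ lam β γ T K = γ * (((K : ℝ) - 1) / D K) := by
    intro K hK
    have hK1 : ((K : ℝ) - 1) ≠ 0 := by
      have : (2 : ℝ) ≤ K := by exact_mod_cast hK
      linarith
    rw [hDK K (by omega), mul_assoc, div_mul_cancel_left₀ hK1, mul_inv, ← mul_assoc, mul_inv_cancel₀ hγ.ne', one_mul,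
      one_div]
  refine ⟨C / γ, fun N M hN hM => ?_⟩
  have h0 := h N M hN hM
  rw [Real.rpow_zero, mul_one, hres N hN, hres M hM, hres (N + M) (by omega)] at h0
  have hNM : (((N + M : ℕ) : ℝ) - 1) / D (N + M) = ((N : ℝ) + (M : ℝ) - 1) / D (N + M) := by
    push_cast
    ring
  rw [hNM] at h0
  have hγ' : 0 ≤ 1 / γ := (one_div_pos.mpr hγ).le
  have h1 := mul_le_mul_of_nonneg_left h0 hγ'
  have e1 : 1 / γ * γ = 1 := one_div_mul_cancel hγ.ne'
  have e2 : C / γ = 1 / γ * C := by ring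
  rw [e2]
  nlinarith [h1, e1]

/-- **11748 ⟹ `J(0)`** (E-frame): instantiate `SuperadditiveResistance` along the canonical response family (`exists_canonical_response`;
positivity of its coefficients is the tree theorem `PositiveConductance`), and convert `(K−1)/D_K = (1/γ)(1/E_K)`; constant
`max (γC) 0`. [costume · corner] -/
theorem junctionLaw_zero_of_superadditiveResistance (hS : SuperadditiveResistance) : JunctionLaw 0 := by
  intro ω₂ lam β γ hω hl hβ hγ T hT
  obtain ⟨μ, hμ, D, hD, hDE⟩ := exists_canonical_response hω hl hβ hγ hT
  have huniq := bondHeatUncertainty_nessUnique_holds ω₂ lam β γ hω hl hβ hγ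
  have hDpos : ∀ N : ℕ, 2 ≤ N → 0 < D N := fun N hN =>
    Summit.AtomisticToContinuum.FouriersLaw.Cruxes.SuperadditiveResistance.ThermaliseThenCutProbeInsertion.positiveConductance_proof
      ω₂ lam β γ hω hl hβ hγ huniq μ hμ T hT D hD N hN
  obtain ⟨C, hC⟩ := hS ω₂ lam β γ hω hl hβ hγ huniq μ hμ T hT D hD hDpos
  have hres : ∀ K : ℕ, 2 ≤ K → 1 / escapeDeficit ω₂ lam β γ T K = γ * (((K : ℝ) - 1) / D K) := by
    intro K hK
    have hK1 : ((K : ℝ) - 1) ≠ 0 := by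
      have : (2 : ℝ) ≤ K := by exact_mod_cast hK
      linarith
    rw [hDE K (by omega), mul_assoc, div_mul_cancel_left₀ hK1, mul_inv, ← mul_assoc, mul_inv_cancel₀ hγ.ne', one_mul,
      one_div]
  refine ⟨max (γ * C) 0, le_max_right _ _, fun N M hN hM => ?_⟩
  have h := hC N M hN hM
  have hNM : ((N : ℝ) + (M : ℝ) - 1) / D (N + M) = (((N + M : ℕ) : ℝ) - 1) / D (N + M) := by
    push_cast
    ring
  rw [hNM] at h
  rw [Real.rpow_zero, mul_one, hres N hN, hres M hM, hres (N + M) (by omega)]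
  have h1 := mul_le_mul_of_nonneg_left h hγ.le
  have h2 : γ * C ≤ max (γ * C) 0 := le_max_left _ _
  nlinarith [h1, h2]

/-- **`J(0) ⟺ 11748`**: the `θ = 0` corner of the junction ladder IS `JunctionLocality.SuperadditiveResistance` (E-frame ⟷ D-frame).
Tag: COSTUME of 11748 at the corner. [costume · corner] -/
theorem junctionLaw_zero_iff_superadditiveResistance : JunctionLaw 0 ↔ SuperadditiveResistance :=
  ⟨superadditiveResistance_of_junctionLaw_zero, junctionLaw_zero_of_superadditiveResistance⟩

/-- **Top corner: a linear conductance floor gives every `J(θ)`, `θ ≥ 1`** (then `1/E_K ≤ K/c` and the law with `C = 1/c` has a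
non-positive left side).  So the junction ladder is inert at `θ ≥ 1` (REP-grade), and the kernel needs `s > θ ≥ 1` there — stronger
than 11071: the informative window is `0 < θ < 1`. [folklore · corner] -/
theorem junctionLaw_of_conductanceFloor {θ : ℝ} (hθ : 1 ≤ θ) : ConductanceFloor → JunctionLaw θ := by
  intro h ω₂ lam β γ hω hl hβ hγ T hT
  obtain ⟨c, hc, hcN⟩ := h ω₂ lam β γ hω hl hβ hγ T hT
  have hEpos : ∀ K : ℕ, 2 ≤ K → 0 < escapeDeficit ω₂ lam β γ T K := fun K hK =>
    escapeDeficit_pos hω hl hβ hγ hT hK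
  have hinv : ∀ K : ℕ, 2 ≤ K → 1 / escapeDeficit ω₂ lam β γ T K ≤ (K : ℝ) / c := by
    intro K hK
    rw [le_div_iff₀ hc, one_div_mul_eq_div, div_le_iff₀ (hEpos K hK)]
    exact hcN K hK
  refine ⟨1 / c, (one_div_pos.mpr hc).le, fun N M hN hM => ?_⟩
  have hx1 : (1 : ℝ) ≤ (N : ℝ) + M := by
    have : (2 : ℝ) ≤ N := by exact_mod_cast hN
    have : (2 : ℝ) ≤ M := by exact_mod_cast hM
    linarith
  have hpow : (N : ℝ) + M ≤ ((N : ℝ) + M) ^ θ := by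
    have h' := Real.rpow_le_rpow_of_exponent_le hx1 hθ
    rwa [Real.rpow_one] at h'
  have h3 : 1 / c * ((N : ℝ) + M) ≤ 1 / c * ((N : ℝ) + M) ^ θ :=
    mul_le_mul_of_nonneg_left hpow (one_div_pos.mpr hc).le
  have h4 : (N : ℝ) / c + (M : ℝ) / c = 1 / c * ((N : ℝ) + M) := by ring
  have h5 : 0 < 1 / escapeDeficit ω₂ lam β γ T (N + M) := one_div_pos.mpr (hEpos (N + M) (by omega))
  linarith [hinv N hN, hinv M hM]

/-- **The node, packaged.**  `11071 ⟸ ∃ θ s, 0 ≤ θ < s ≤ 1 ∧ J(θ) ∧ F(s)`; conversely 11071 returns `F(s)` for every `s ≤ 1`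
(`exponentFloor_of_boundedResponse`) — it does NOT return `J(θ)` for `θ < 1` (not claimed: the junction law is side information about
the series structure, priced by the instrument, exactly like 11748 in route JunctionLocality). [kernel · frame] -/
theorem boundedResponse_of_exists_grading :
    (∃ θ s : ℝ, 0 ≤ θ ∧ θ < s ∧ s ≤ 1 ∧ JunctionLaw θ ∧ ExponentFloor s) → BoundedResponse := by
  rintro ⟨θ, s, hθ, hθs, hs, hJ, hF⟩
  exact boundedResponse_of_junctionLaw_of_exponentFloor hθ hθs hs hJ hF

/-- The node packaged in its weakest (near-diagonal) form: `11071 ⟸ ∃ θ s, 0 ≤ θ < s ≤ 1 ∧ D(θ) ∧ F(s)`. [kernel · frame] -/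
theorem boundedResponse_of_exists_doubling_grading :
    (∃ θ s : ℝ, 0 ≤ θ ∧ θ < s ∧ s ≤ 1 ∧ DoublingLaw θ ∧ ExponentFloor s) → BoundedResponse := by
  rintro ⟨θ, s, hθ, hθs, hs, hD, hF⟩
  exact boundedResponse_of_doublingLaw_of_exponentFloor hθ hθs hs hD hF

end JunctionDefectGrading

end Summit.AtomisticToContinuum.FouriersLaw.Theorems.SubdiffusiveBondHeat
end
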